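import Mathlib
import Literature.MathematicalPhysics.QuantumManyBody.BoseEinsteinCondensation
import Summits.AtomisticToContinuum.BoseEinsteinCondensation.Theorems.SoloBlindPlateauCondensation

/-!
# Jastrow-type amplitudes condense uniformly in `N`

Solo seat `solo-AtomisticToContinuum-blind`, conjunct `BoseEinsteinCondensation`.

The bookkeeping behind the remark in `SoloBlindPlateauCondensation`: if the conditional amplitude
of the first particle factorises as
`Φ (x :: Y) = 1_S(x) · ∏ⱼ f (x − Yⱼ) · F(Y)` with a **Jastrow factor** `0 ≤ f ≤ 1`, `f = 1` outside
the ball of radius `R`, and `F ≥ 0` (for `Ψ_J = ∏_{i<j} f(xᵢ − xⱼ)` restricted to `S^{n+1}`,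
`F(Y) = 1_{S^n}(Y) ∏_{i<j} f(Yᵢ − Yⱼ) / ‖Ψ_J‖`), then
`(n+1) · (1 − n·|B_R|/|S|)² ≤ maxOccupation (n+1) Φ`
(`mul_sq_le_maxOccupation_of_jastrow_factor`).  At fixed density `n/|S| = ρ` with
`ρ |B_R| < 1` this is a macroscopic occupation of the uniform mode for every `n` — the free-volume
picture of Penrose–Onsager with the union bound as a rigorous floor.
-/

open MeasureTheory
open scoped ENNReal

namespace Summit.AtomisticToContinuum.BoseEinsteinCondensation.Theorems

open Literature.MathematicalPhysics.QuantumManyBody.BoseGas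

/-- **Finite-range `[0,1]`-valued Jastrow factors give condensation uniformly in `n`.** -/
theorem mul_sq_le_maxOccupation_of_jastrow_factor {n : ℕ} {S : Set Space}
    (hS : MeasurableSet S) (hS0 : volume S ≠ 0) (hStop : volume S ≠ ⊤)
    {f : Space → ℝ} {R : ℝ} (hf0 : 0 ≤ f) (hf1 : f ≤ 1) (hfR : ∀ x, R ≤ ‖x‖ → f x = 1)
    {F : Config n → ℝ} (hF0 : 0 ≤ F) {Φ : Config (n + 1) → ℝ} (hΦm : Measurable Φ)
    (hΦ1 : ∫⁻ Y : Config n, ∫⁻ x, ENNReal.ofReal (Φ (Matrix.vecCons x Y)) ^ 2 = 1)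
    (hprod : ∀ Y x, Φ (Matrix.vecCons x Y) =
      S.indicator (fun _ => (1 : ℝ)) x * (∏ j : Fin n, f (x - Y j)) * F Y) :
    (n + 1 : ℝ≥0∞) * (1 - n * volume (Metric.ball (0 : Space) R) / volume S) ^ 2 ≤
      maxOccupation (n + 1) (fun X => (Φ X : ℂ)) := by
  have hind0 : ∀ x, 0 ≤ S.indicator (fun _ => (1 : ℝ)) x := fun x =>
    Set.indicator_nonneg (fun _ _ => zero_le_one) x
  have hind1 : ∀ x, S.indicator (fun _ => (1 : ℝ)) x ≤ 1 := fun x =>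
    Set.indicator_le_self' (fun _ _ => zero_le_one) x
  have hprod0 : ∀ (Y : Config n) x, 0 ≤ ∏ j : Fin n, f (x - Y j) := fun Y x =>
    Finset.prod_nonneg fun j _ => hf0 _
  have hprod1 : ∀ (Y : Config n) x, ∏ j : Fin n, f (x - Y j) ≤ 1 := fun Y x =>
    Finset.prod_le_one (fun j _ => hf0 _) fun j _ => hf1 _
  -- nonnegativity of `Φ` on all of `Config (n+1)` via the decomposition `X = X 0 :: tail X`
  have hΦ0 : 0 ≤ Φ := by
    intro X
    have hX : X = Matrix.vecCons (X 0) (Matrix.vecTail X) := (Matrix.cons_head_tail X).symm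
    rw [Pi.zero_apply, hX, hprod]
    exact mul_nonneg (mul_nonneg (hind0 _) (hprod0 _ _)) (hF0 _)
  refine mul_sq_le_maxOccupation_of_plateau_off_balls hS hS0 hStop hΦ0 hΦm hΦ1
    (F := F) (R := R) ?_ ?_ ?_
  · intro Y x
    rw [hprod]
    calc S.indicator (fun _ => (1 : ℝ)) x * (∏ j : Fin n, f (x - Y j)) * F Y
        ≤ 1 * 1 * F Y :=
          mul_le_mul_of_nonneg_right
            (mul_le_mul (hind1 x) (hprod1 Y x) (hprod0 Y x) zero_le_one) (hF0 _)
      _ = F Y := by ring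
  · intro Y x hx
    rw [hprod, Set.indicator_of_notMem hx, zero_mul, zero_mul]
  · intro Y x hx hfar
    rw [hprod, Set.indicator_of_mem hx, one_mul]
    have : ∏ j : Fin n, f (x - Y j) = 1 := by
      refine Finset.prod_eq_one fun j _ => hfR _ ?_
      rw [← dist_eq_norm]
      exact hfar j
    rw [this, one_mul]

end Summit.AtomisticToContinuum.BoseEinsteinCondensation.Theorems
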